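/-
Copyright (c) 2026. All rights reserved.
Released under Apache 2.0 license as described in the file LICENSE.
Authors: abc-iut cell, prover seat abc-iut-f-045 (gen 7).
-/
import Literature.IUT.LogVolume.AdjoinCubeRootOfUnityDifferent
import Literature.NumberTheory.NumberFields.MinkowskiRootDiscriminantThresholds
import HarnessLib

/-!
# The discriminant of `F(ζ₃)`: `|d_{F(ζ₃)}| ≤ 3^{Σ_{v ∣ 3, e(v|3)=1} f(v|3)} · d_F²`, and the degree-doubling cut
# «a field of degree `≥ 4` with every place over `3` unramified or `(2,1)` and `|d_F| ≤ 2^{[F:ℚ]}·3^{#(2,1)}` contains `√−3`»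

Classical algebraic number theory (nothing disputed; no definition, no `Prop` fact, no instance).  Sequel to
`AdjoinCubeRootOfUnityDifferent.lean`.  For number fields `F ⊆ E = F(ζ)`, `ζ` a primitive cube root of unity with `X² + X + 1`
irreducible over `F`, such that every prime of `𝓞_F` over `3` has ramification index `≤ 2`:

* `differentIdeal_sq_dvd` — `𝔇(𝓞_E/𝓞_F)² ∣ J·𝓞_E` with `J = ∏_{v ∣ 3, e(v|3) = 1} 𝔭_v` (prime by prime, from the three local
  statements of the prequel);
* `absNorm_differentIdeal_le` — `N(𝔇(𝓞_E/𝓞_F)) ≤ 3^{Σ_{v ∣ 3, e(v|3)=1} f(v|3)}` (`N(J𝓞_E) = N(J)^{[E:F]} = N(J)²`);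
* `natAbs_discr_le` — **`|d_E| ≤ 3^{Σ_{v ∣ 3, e(v|3)=1} f(v|3)} · d_F²`** (Mathlib's discriminant tower
  `natAbs_discr_eq_absNorm_differentIdeal_mul_natAbs_discr_pow`);
* `exists_sq_eq_neg_three_of_four_le_finrank` — **THE DEGREE-DOUBLING CUT**: a number field `F` with `[F:ℚ] ≥ 4`, every
  place over `3` unramified or a `(2,1)`-place, and `|d_F| ≤ 2^{[F:ℚ]} · 3^{#{v ∣ 3 : e = 2}}`, contains a square root of `−3`.
  Otherwise `E = F(ζ₃) = CyclotomicField 3 F` is a number field of degree `2[F:ℚ] ≥ 8` with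
  `|d_E| ≤ 3^{[F:ℚ] − 2a} · (2^{[F:ℚ]} 3^a)² = 12^{[F:ℚ]} = 12^{[E:ℚ]/2}` (the fundamental identity `Σ_{v ∣ 3} e_v f_v = [F:ℚ]`),
  against Minkowski's `12^{[E:ℚ]} < d_E²` for `[E:ℚ] ≥ 7` (`Literature.NumberTheory.NumberFields.twelve_pow_lt_discr_sq`):
  adjoining `ζ₃` doubles the degree past the Minkowski threshold `n₀ = 7` while keeping the root discriminant `≤ 2√3`.

Consumer: the abc-iut cell's branch E, R-J row Y-26 (pinned number fields have exactly these local shapes and `|d_F| = 4^b 3^a`,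
`2b ≤ [F:ℚ]`; `Summits/ABC/IUTFork/Joshi/TestGenuinePinsVacuityAllDegrees.lean`).  Nothing here is specific to that consumer.
[cite: NeukirchANT1999, Ch. III Thm. (2.6), Cor. (2.10), Thm. (2.14)] [cite: EsmondeMurty1999, Ex. 6.5.12 and Ex. 6.5.21 p. 93]
-/

noncomputable section

open NumberField Polynomial IsDedekindDomain Module

namespace Literature.IUT.LogVolume

namespace AdjoinCubeRoot

open Literature.NumberTheory.NumberFields

variable {F E : Type} [Field F] [NumberField F] [Field E] [NumberField E] [Algebra F E]

/-- `N(I·𝓞_E) = N(I)^{[E:F]}` for an ideal `I ⊆ 𝓞_F` (Mathlib's `Ideal.absNorm_algebraMap`, with the `FractionRing`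
degree identified with `[E:F]`). [folklore] -/
private theorem absNorm_map_eq_pow (I : Ideal (𝓞 F)) :
    Ideal.absNorm (I.map (algebraMap (𝓞 F) (𝓞 E))) = Ideal.absNorm I ^ finrank F E := by
  letI : Algebra (FractionRing (𝓞 F)) (FractionRing (𝓞 E)) := FractionRing.liftAlgebra (𝓞 F) (FractionRing (𝓞 E))
  rw [Ideal.absNorm_algebraMap, Algebra.finrank_eq_of_equiv_equiv
      (FractionRing.algEquiv (𝓞 F) F).toRingEquiv (FractionRing.algEquiv (𝓞 E) E).toRingEquiv]
  ext
  exact IsFractionRing.algEquiv_commutes (FractionRing.algEquiv (𝓞 F) F)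
    (FractionRing.algEquiv (𝓞 E) E) _

/-! ## 3. The divisibility `𝔇(𝓞_E/𝓞_F)² ∣ (∏_{v ∣ 3, e(v|3) = 1} 𝔭_v)·𝓞_E` and the discriminant bound -/

section Assembly

variable (ζ : 𝓞 E) (hζ : IsPrimitiveRoot (ζ : E) 3) (hirr : Irreducible (cyclotomic 3 F))
  (hgen : Algebra.adjoin F {(ζ : E)} = ⊤)
  (h3 : ∀ v : HeightOneSpectrum (𝓞 F), ((3 : ℕ) : 𝓞 F) ∈ v.asIdeal →
    v.asIdeal.ramificationIdx ℤ = 1 ∨ v.asIdeal.ramificationIdx ℤ = 2)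

omit [NumberField F] in
/-- `v ∈ V(F)_p ⇒ p ∈ 𝔭_v` (as in `FixedBallShapesDiscriminant.natCast_mem_of_mem_placesOver`). [folklore] -/
private theorem natCast_mem_of_mem_placesOver' [NumberField F] {p : ℕ} [Fact p.Prime] {v : HeightOneSpectrum (𝓞 F)}
    (hv : v ∈ placesOver F p) : ((p : ℕ) : 𝓞 F) ∈ v.asIdeal := by
  have h := (mem_placesOver_iff_residueChar v).mp hv
  rw [← h]
  exact natCast_residueChar_mem F v

include hζ hirr hgen in
/-- `𝔇(𝓞_E/𝓞_F) ≠ 0` (it contains `2ζ + 1`, whose square is `−3 ≠ 0`). [folklore] -/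
private theorem differentIdeal_ne_bot' : differentIdeal (𝓞 F) (𝓞 E) ≠ ⊥ := by
  intro h
  have hmem := two_mul_zeta_add_one_mem_differentIdeal ζ hζ hirr hgen
  rw [h, Ideal.mem_bot] at hmem
  have hsq := two_mul_zeta_add_one_sq ζ hζ
  rw [hmem] at hsq
  norm_num at hsq

include hζ hirr hgen h3 in
/-- **`𝔇(𝓞_E/𝓞_F)² ∣ J·𝓞_E`** with `J = ∏_{v ∣ 3, e(v|3) = 1} 𝔭_v`, when every place of `F` over `3` has `e ≤ 2`:
tested prime by prime (`§2`: multiplicity `0` off `3` and at the `e = 2` places, `2·ord_Q 𝔇 ≤ ord_Q(𝔭_v 𝓞_E)` at the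
`e = 1` places). [cite: NeukirchANT1999, Ch. III Thm. (2.6)] -/
theorem differentIdeal_sq_dvd :
    differentIdeal (𝓞 F) (𝓞 E) ^ 2 ∣
      (∏ w ∈ (placesOver F 3).filter (fun w => w.asIdeal.ramificationIdx ℤ = 1), w.asIdeal).map
        (algebraMap (𝓞 F) (𝓞 E)) := by
  classical
  haveI : Fact (Nat.Prime 3) := ⟨Nat.prime_three⟩
  set U := (placesOver F 3).filter (fun w => w.asIdeal.ramificationIdx ℤ = 1) with hU
  have hJ0 : (∏ w ∈ U, w.asIdeal) ≠ ⊥ := by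
    rw [← Ideal.zero_eq_bot, Finset.prod_ne_zero_iff]
    intro w _
    rw [Ideal.zero_eq_bot]
    exact w.ne_bot
  have hJ : (∏ w ∈ U, w.asIdeal).map (algebraMap (𝓞 F) (𝓞 E)) ≠ ⊥ := Ideal.map_ne_bot_of_ne_bot hJ0
  have hD : differentIdeal (𝓞 F) (𝓞 E) ^ 2 ≠ ⊥ := pow_ne_zero 2 (differentIdeal_ne_bot' ζ hζ hirr hgen)
  refine Ideal.dvd_of_forall_emultiplicity_le hD hJ fun P hPmax hP0 => ?_
  haveI := hPmax
  have hPprime : Prime P := Ideal.prime_of_isPrime hP0 hPmax.isPrime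
  have hmap : (∏ w ∈ U, w.asIdeal).map (algebraMap (𝓞 F) (𝓞 E)) =
      ∏ w ∈ U, (w.asIdeal.map (algebraMap (𝓞 F) (𝓞 E))) :=
    map_prod (Ideal.mapHom (algebraMap (𝓞 F) (𝓞 E))) _ _
  rw [emultiplicity_pow hPprime, hmap, Finset.emultiplicity_prod hPprime]
  by_cases hP3 : ((3 : ℕ) : 𝓞 E) ∈ P
  · haveI : (P.under (𝓞 F)).IsMaximal := Ideal.IsMaximal.under (𝓞 F) P
    have hq0 : P.under (𝓞 F) ≠ ⊥ := fun h => hP0 (Ideal.eq_bot_of_comap_eq_bot h)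
    have h3F : ((3 : ℕ) : 𝓞 F) ∈ P.under (𝓞 F) := by
      rw [Ideal.under_def, Ideal.mem_comap, map_natCast]; exact hP3
    let w₀ : HeightOneSpectrum (𝓞 F) := ⟨P.under (𝓞 F), Ideal.IsMaximal.isPrime inferInstance, hq0⟩
    rcases h3 w₀ h3F with he1 | he2
    · have hw₀ : w₀ ∈ U := by
        rw [hU, Finset.mem_filter]
        exact ⟨(mem_placesOver_iff w₀).mpr (liesOver_span_of_natCast_mem F 3 w₀ h3F), he1⟩
      calc (2 : ℕ) * emultiplicity P (differentIdeal (𝓞 F) (𝓞 E))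
          ≤ emultiplicity P ((P.under (𝓞 F)).map (algebraMap (𝓞 F) (𝓞 E))) := by
            rw [Nat.cast_ofNat]
            exact two_mul_emultiplicity_differentIdeal_le ζ hζ hirr hgen P hP0 hP3 he1
        _ = emultiplicity P (w₀.asIdeal.map (algebraMap (𝓞 F) (𝓞 E))) := rfl
        _ ≤ ∑ w ∈ U, emultiplicity P (w.asIdeal.map (algebraMap (𝓞 F) (𝓞 E))) :=
            Finset.single_le_sum (f := fun w => emultiplicity P (w.asIdeal.map (algebraMap (𝓞 F) (𝓞 E))))
              (fun _ _ => zero_le) hw₀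
    · rw [emultiplicity_differentIdeal_eq_zero_of_ramificationIdx_eq_two ζ hζ hirr hgen P hP0 hP3 he2, mul_zero]
      exact zero_le
  · haveI := hPmax.isPrime
    rw [emultiplicity_differentIdeal_eq_zero_of_three_not_mem ζ hζ hirr hgen P hP3, mul_zero]
    exact zero_le

include hζ hirr hgen h3 in
/-- **`N(𝔇(𝓞_E/𝓞_F)) ≤ 3^{Σ_{v ∣ 3, e(v|3)=1} f(v|3)}`** (norms of both sides of `differentIdeal_sq_dvd`,
`N(J𝓞_E) = N(J)^{[E:F]} = N(J)²`). [cite: NeukirchANT1999, Ch. III Thm. (2.6), (2.9)] -/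
theorem absNorm_differentIdeal_le (hdeg : finrank F E = 2) :
    Ideal.absNorm (differentIdeal (𝓞 F) (𝓞 E)) ≤
      3 ^ ∑ w ∈ (placesOver F 3).filter (fun w => w.asIdeal.ramificationIdx ℤ = 1), w.asIdeal.inertiaDeg ℤ := by
  classical
  haveI : Fact (Nat.Prime 3) := ⟨Nat.prime_three⟩
  set U := (placesOver F 3).filter (fun w => w.asIdeal.ramificationIdx ℤ = 1) with hU
  have hdvd := map_dvd Ideal.absNorm (differentIdeal_sq_dvd ζ hζ hirr hgen h3)
  rw [map_pow, absNorm_map_eq_pow, hdeg, Nat.pow_dvd_pow_iff two_ne_zero] at hdvd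
  have hJ0 : (∏ w ∈ U, w.asIdeal) ≠ ⊥ := by
    rw [← Ideal.zero_eq_bot, Finset.prod_ne_zero_iff]
    intro w _
    rw [Ideal.zero_eq_bot]
    exact w.ne_bot
  have hN0 : Ideal.absNorm (∏ w ∈ U, w.asIdeal) ≠ 0 := by
    rw [Ne, Ideal.absNorm_eq_zero_iff]; exact hJ0
  refine (Nat.le_of_dvd (Nat.pos_of_ne_zero hN0) hdvd).trans (le_of_eq ?_)
  rw [map_prod, ← Finset.prod_pow_eq_pow_sum]
  refine Finset.prod_congr rfl fun w hw => ?_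
  rw [hU, Finset.mem_filter] at hw
  exact absNorm_eq_pow_inertiaDeg F 3 w (natCast_mem_of_mem_placesOver' hw.1)

include hζ hirr hgen h3 in
/-- **THE DISCRIMINANT OF `E = F(ζ₃)`: `|d_E| ≤ 3^{Σ_{v ∣ 3, e(v|3)=1} f(v|3)} · d_F²`** for a number field `F` all of whose
places over `3` have `e ≤ 2` and `ζ₃ ∉ F` (Mathlib's discriminant tower `|d_E| = N(𝔇(𝓞_E/𝓞_F))·|d_F|^{[E:F]}`).
[cite: NeukirchANT1999, Ch. III Cor. (2.10) and Thm. (2.6)] -/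
theorem natAbs_discr_le (hdeg : finrank F E = 2) :
    (discr E).natAbs ≤
      3 ^ (∑ w ∈ (placesOver F 3).filter (fun w => w.asIdeal.ramificationIdx ℤ = 1), w.asIdeal.inertiaDeg ℤ) *
        (discr F).natAbs ^ 2 := by
  rw [NumberField.natAbs_discr_eq_absNorm_differentIdeal_mul_natAbs_discr_pow F (𝓞 F) E (𝓞 E), hdeg]
  exact Nat.mul_le_mul_right _ (absNorm_differentIdeal_le ζ hζ hirr hgen h3 hdeg)

end Assembly

/-! ## 4. The degree-doubling cut -/

/-- **A number field of degree `≥ 4` whose places over `3` are all unramified or `(2,1)`-places, and whose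
discriminant satisfies `|d_F| ≤ 2^{[F:ℚ]} · 3^{#{v ∣ 3 : e(v|3) = 2}}`, contains `√−3`.**  Otherwise `E := F(ζ₃)` is a number
field of degree `2[F:ℚ] ≥ 8` with `|d_E| ≤ 3^{[F:ℚ] − 2a}·d_F² ≤ 12^{[F:ℚ]} = 12^{[E:ℚ]/2}` (`natAbs_discr_le`, the identity
`Σ_{v∣3} e_v f_v = [F:ℚ]`), contradicting Minkowski's `12^{[E:ℚ]} < d_E²` for `[E:ℚ] ≥ 7`
(`Literature.NumberTheory.NumberFields.twelve_pow_lt_discr_sq`). [cite: NeukirchANT1999, Ch. III Cor. (2.10), Thm. (2.14)]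
[cite: EsmondeMurty1999, Ex. 6.5.12 and Ex. 6.5.21 p. 93] -/
theorem exists_sq_eq_neg_three_of_four_le_finrank (F : Type) [Field F] [NumberField F] (h4 : 4 ≤ finrank ℚ F)
    (h3 : ∀ v : HeightOneSpectrum (𝓞 F), ((3 : ℕ) : 𝓞 F) ∈ v.asIdeal →
      v.asIdeal.ramificationIdx ℤ = 1 ∨ (v.asIdeal.ramificationIdx ℤ = 2 ∧ v.asIdeal.inertiaDeg ℤ = 1))
    (hd : (discr F).natAbs ≤
      2 ^ finrank ℚ F * 3 ^ ((placesOver F 3).filter (fun v => v.asIdeal.ramificationIdx ℤ = 2)).card) :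
    ∃ s : F, s ^ 2 = -3 := by
  classical
  haveI : Fact (Nat.Prime 3) := ⟨Nat.prime_three⟩
  by_contra hno
  push Not at hno
  -- `X² + X + 1` is irreducible over `F`
  have hirr : Irreducible (cyclotomic 3 F) := by
    have hp : (cyclotomic 3 F).Monic := cyclotomic.monic 3 F
    have hdeg2 : (cyclotomic 3 F).natDegree = 2 := by
      rw [natDegree_cyclotomic, Nat.totient_prime Nat.prime_three]
    refine (hp.irreducible_iff_roots_eq_zero_of_degree_le_three (by omega) (by omega)).mpr ?_
    refine Multiset.eq_zero_of_forall_notMem fun r hr => ?_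
    rw [mem_roots hp.ne_zero, cyclotomic_three, IsRoot.def] at hr
    simp only [eval_add, eval_pow, eval_X, eval_one] at hr
    exact hno (2 * r + 1) (by linear_combination (4 : F) * hr)
  -- `E = F(ζ₃)`
  let E := CyclotomicField 3 F
  have hζ₀ := IsCyclotomicExtension.zeta_spec 3 F E
  let ζ : 𝓞 E := ⟨IsCyclotomicExtension.zeta 3 F E, hζ₀.isIntegral (by norm_num)⟩
  have hζ : IsPrimitiveRoot (ζ : E) 3 := hζ₀
  have hgen : Algebra.adjoin F {(ζ : E)} = ⊤ := IsCyclotomicExtension.adjoin_primitive_root_eq_top hζ₀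
  have hdeg : finrank F E = 2 := by
    rw [IsCyclotomicExtension.finrank E hirr, Nat.totient_prime Nat.prime_three]
  have hE : finrank ℚ E = 2 * finrank ℚ F := by
    rw [← Module.finrank_mul_finrank ℚ F E, hdeg, mul_comm]
  have h3' : ∀ v : HeightOneSpectrum (𝓞 F), ((3 : ℕ) : 𝓞 F) ∈ v.asIdeal →
      v.asIdeal.ramificationIdx ℤ = 1 ∨ v.asIdeal.ramificationIdx ℤ = 2 :=
    fun v hv => (h3 v hv).imp_right And.left
  have hA := natAbs_discr_le ζ hζ hirr hgen h3' hdeg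
  -- `Σ_{v ∣ 3, e=1} f_v + 2·#{e = 2} = [F:ℚ]`
  set a := ((placesOver F 3).filter (fun v => v.asIdeal.ramificationIdx ℤ = 2)).card with ha
  have hsum : (∑ w ∈ (placesOver F 3).filter (fun w => w.asIdeal.ramificationIdx ℤ = 1), w.asIdeal.inertiaDeg ℤ) +
      2 * a = finrank ℚ F := by
    rw [← sum_localDeg F 3, ← Finset.sum_filter_add_sum_filter_not (placesOver F 3)
      (fun w => w.asIdeal.ramificationIdx ℤ = 1)]
    congr 1
    · refine Finset.sum_congr rfl fun w hw => ?_
      rw [Finset.mem_filter] at hw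
      rw [localDeg, hw.2, one_mul]
    · have hfilt : (placesOver F 3).filter (fun w => ¬ w.asIdeal.ramificationIdx ℤ = 1) =
          (placesOver F 3).filter (fun v => v.asIdeal.ramificationIdx ℤ = 2) := by
        refine Finset.filter_congr fun w hw => ?_
        rcases h3 w (natCast_mem_of_mem_placesOver' hw) with he | ⟨he, -⟩
        · simp [he]
        · simp [he]
      rw [ha, ← hfilt, Finset.card_eq_sum_ones, Finset.mul_sum]
      refine Finset.sum_congr rfl fun w hw => ?_
      rw [Finset.mem_filter] at hw
      rcases h3 w (natCast_mem_of_mem_placesOver' hw.1) with he | ⟨he, hf⟩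
      · exact absurd he hw.2
      · rw [localDeg, he, hf]
  -- `|d_E| ≤ 12^{[F:ℚ]}`
  obtain ⟨m, hm⟩ : ∃ m, finrank ℚ F = m + 2 * a := ⟨finrank ℚ F - 2 * a, by omega⟩
  have hS : (∑ w ∈ (placesOver F 3).filter (fun w => w.asIdeal.ramificationIdx ℤ = 1), w.asIdeal.inertiaDeg ℤ) =
      m := by omega
  have h12 : (12 : ℕ) ^ (m + 2 * a) = 3 ^ (m + 2 * a) * 2 ^ (2 * (m + 2 * a)) := by
    rw [pow_mul, ← mul_pow]; norm_num
  have hB : (discr E).natAbs ≤ 12 ^ finrank ℚ F := by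
    refine hA.trans ?_
    rw [hS]
    calc 3 ^ m * (discr F).natAbs ^ 2
        ≤ 3 ^ m * (2 ^ finrank ℚ F * 3 ^ a) ^ 2 := by gcongr
      _ = 12 ^ finrank ℚ F := by rw [hm, h12]; ring
  -- Minkowski at degree `2[F:ℚ] ≥ 8`
  have hM := twelve_pow_lt_discr_sq E (by omega)
  rw [hE] at hM
  have hB' : ((discr E).natAbs : ℤ) ^ 2 ≤ (12 : ℤ) ^ (2 * finrank ℚ F) := by
    have h : ((discr E).natAbs : ℤ) ≤ (12 : ℤ) ^ finrank ℚ F := by exact_mod_cast hB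
    calc ((discr E).natAbs : ℤ) ^ 2 ≤ ((12 : ℤ) ^ finrank ℚ F) ^ 2 := by gcongr
      _ = 12 ^ (2 * finrank ℚ F) := by rw [← pow_mul, mul_comm]
  rw [Int.natCast_natAbs, sq_abs] at hB'
  exact lt_irrefl _ (hM.trans_le hB')

end AdjoinCubeRoot

end Literature.IUT.LogVolume
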